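import Summits.CriticalPhenomena.PercolationContinuityZ3.Theorems.Transplant.AutChartOrbitsCriticalContinuity
import HarnessLib

/-!
# `θ(p_c) = 0` on the SKEW BILAYER `X = Cay(ℤ² ⋊ C₂; τ₀, τ₁, τ₀σ, τ₁σ)` — a Cayley graph of a group with FINITE ABELIANISATION, through the
# orbit theorem «AutChartOrbitsCriticalContinuity» with TWO orbits of the translation subgroup (customer (c3) of P3-NILPOTENT §20.2)

builds on p205010 (kernel theorem, internal audit signed; external expert review pending): the unconditional theorem of this file is an instance of
`AutChart.criticalContinuity_of_autSubgroup_finite_orbits` («AutChartOrbitsCriticalContinuity» §5, p493117), which runs through the aligned multi-type scaled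
node «SkelFrmScaledAlignedHoldsAll» (p490798) and so builds on p205010.  Lane `prim-bschramm`, seat `prim-hp-8` gen 58 (port pen; row (c3) handed over by
the design owner p3 gen 28, bus 2026-08-27 #5861).  Helper file (`--supports stmt-CriticalPhenomena-4575 --as helper`); no node, no statement, no
`@[conjecture]` is declared or edited; nothing about the end-state node or Conj. 4 in general is claimed.

THE GRAPH.  `Γ = ℤ² ⋊ C₂`, the generator `σ` of `C₂` acting on `ℤ²` by `v ↦ −v` (the generalised dihedral group of `ℤ²`; `Γ^{ab} = (ℤ/2)³` is finite, so
`b₁(Γ) = 0` and NO Cayley graph of `Γ` carries a chart translated by a vertex-transitive group of left translations; its index-two subgroup `ℤ²` surjects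
onto `ℤ²`).  Alphabet `S = {τ₀, τ₁, τ₀σ, τ₁σ}` with `τᵢ = (eᵢ, 1)`, `τᵢσ = (eᵢ, σ)` (two involutions).  Right multiplication on `(v, ε)`:
`(v, ε) · τᵢ^{±1} = (v ± ε eᵢ, ε)` — the axis steps inside each of the two sheets `ε = 1, σ`; `(v, 1) · τᵢσ = (v + eᵢ, σ)` and `(v, σ) · τᵢσ = (v − eᵢ, 1)` —
the SKEW RUNGS.  In coordinates (`Vtx = ℤ² × Fin 2`, sheet `1 ↦ 0`, sheet `σ ↦ 1`): **`(v, j) ∼ (v ± eᵢ, j)`** and **`(v, 0) ∼ (v + eᵢ, 1)`** (`i = 0, 1`);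
6-regular.  (The identification with the Cayley graph is read in coordinates and stated, not typed, here.)

THE PROOF (ten lines of customer work over the orbit theorem).  `A :=` the translations `(w, j) ↦ (w + u, j)`, `u ∈ ℤ²` (left multiplications by the
normal subgroup `ℤ²`; the range of `shiftHom`) — a subgroup of `Aut(X)` with exactly TWO orbits, the sheets; transversal `reps = {(0,0), (0,1)}`; chart
`φ(v, j) := v`, translated by `A` and CONSTANT (`= 0`) on the transversal; scale `N := 1`: along every bond the position moves by a vector of sup-norm `≤ 1`,
and at each representative the four in-sheet bonds realise `± e₀, ± e₁` exactly.  `X` is connected (walk the position inside sheet `0`; a skew rung joins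
sheet `1` to sheet `0`) and locally finite.  Hence `AutChart.criticalContinuity_of_autSubgroup_finite_orbits`:
**`Z2DihSkew.criticalContinuity : ∀ v, θ_v(p_c(X)) = 0` — unconditional** — with NO cylinder, growth, degree or uniqueness verification in this file (the
orbit theorem takes care of Hutchcroft's alternative and of the kernel walks).
[cite: BenjaminiSchramm1996, Conj. 4; §2 (Cayley graphs)] [cite: KozmaNitzan2024, §4 p. 16 (Lemma 8: the lattice symmetries)] [this work]
-/

noncomputable section

namespace Summit.CriticalPhenomena.PercolationContinuityZ3.Theorems.Transplant

open MeasureTheory Literature.Probability.Percolation Literature.Probability.LatticeModels SimpleGraph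
open scoped Classical

namespace Z2DihSkew

/-! ## §1 The skew bilayer `X = Cay(ℤ² ⋊ C₂; τ₀, τ₁, τ₀σ, τ₁σ)` -/

/-- The vertices: position and sheet. [folklore] -/
abbrev Vtx : Type := Site 2 × Fin 2

/-- The unit vectors `e₀, e₁` of `ℤ²`. [folklore] -/
def e (i : Fin 2) : Site 2 := Pi.single i 1

/-- `eᵢ ≠ 0`. [folklore] -/
theorem e_ne_zero (i : Fin 2) : e i ≠ 0 := fun h => by
  have := congrFun h i
  simp [e] at this

/-- The coordinates of `eᵢ` are `0` or `1`. [folklore] -/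
theorem abs_e_le (k i : Fin 2) : |e k i| ≤ 1 := by
  fin_cases k <;> fin_cases i <;> simp [e]

/-- **The skew bilayer**: generating relation = an axis step inside a sheet, or a skew rung `(v, 0) ↦ (v + eᵢ, 1)`.
[cite: BenjaminiSchramm1996, §2 (Cayley graphs)] -/
def graph : SimpleGraph Vtx :=
  SimpleGraph.fromRel fun a b => (b.2 = a.2 ∧ (b.1 = a.1 + e 0 ∨ b.1 = a.1 + e 1)) ∨ (a.2 = 0 ∧ b.2 = 1 ∧ (b.1 = a.1 + e 0 ∨ b.1 = a.1 + e 1))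

/-- Adjacency unfolded. [folklore] -/
theorem adj_iff (a b : Vtx) : graph.Adj a b ↔ a ≠ b ∧
    (((b.2 = a.2 ∧ (b.1 = a.1 + e 0 ∨ b.1 = a.1 + e 1)) ∨ (a.2 = 0 ∧ b.2 = 1 ∧ (b.1 = a.1 + e 0 ∨ b.1 = a.1 + e 1))) ∨
      ((a.2 = b.2 ∧ (a.1 = b.1 + e 0 ∨ a.1 = b.1 + e 1)) ∨ (b.2 = 0 ∧ a.2 = 1 ∧ (a.1 = b.1 + e 0 ∨ a.1 = b.1 + e 1)))) :=
  SimpleGraph.fromRel_adj _ _ _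

/-- A vertex differs from its translate by a unit vector. [folklore] -/
theorem ne_add_e (v : Site 2) (j : Fin 2) (i : Fin 2) : ((v, j) : Vtx) ≠ (v + e i, j) := fun h => by
  have := congrArg Prod.fst h
  exact e_ne_zero i (by simpa using this.symm)

/-- An axis step inside a sheet is a bond. [folklore] -/
theorem adj_axis (v : Site 2) (j : Fin 2) (i : Fin 2) : graph.Adj (v, j) (v + e i, j) := by
  refine (adj_iff _ _).2 ⟨ne_add_e v j i, Or.inl (Or.inl ⟨rfl, ?_⟩)⟩
  fin_cases i
  · exact Or.inl rfl
  · exact Or.inr rfl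

/-- An axis step backwards inside a sheet is a bond. [folklore] -/
theorem adj_axis' (v : Site 2) (j : Fin 2) (i : Fin 2) : graph.Adj (v, j) (v - e i, j) := by
  have := (adj_axis (v - e i) j i).symm
  rwa [sub_add_cancel] at this

/-- A skew rung `(v, 0) ∼ (v + eᵢ, 1)` is a bond. [folklore] -/
theorem adj_rung (v : Site 2) (i : Fin 2) : graph.Adj (v, 0) (v + e i, 1) := by
  refine (adj_iff _ _).2 ⟨fun h => by simpa using congrArg Prod.snd h, Or.inl (Or.inr ⟨rfl, rfl, ?_⟩)⟩
  fin_cases i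
  · exact Or.inl rfl
  · exact Or.inr rfl

/-- A skew rung read from sheet `1`: `(v, 1) ∼ (v − eᵢ, 0)`. [folklore] -/
theorem adj_rung' (v : Site 2) (i : Fin 2) : graph.Adj (v, 1) (v - e i, 0) := by
  have := (adj_rung (v - e i) i).symm
  rwa [sub_add_cancel] at this

/-- The sign of the rungs leaving sheet `j`: `+` from sheet `0`, `−` from sheet `1`. [folklore] -/
def sgn : Fin 2 → ℤ := ![1, -1]

/-- `|sgn j| = 1`, coordinatewise on `sgn j • e k`. [folklore] -/
theorem abs_sgn_smul_e_le (j k i : Fin 2) : |(sgn j • e k) i| ≤ 1 := by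
  fin_cases j <;> fin_cases k <;> fin_cases i <;> simp [sgn, e]

/-- The rungs in signed form: `(v, j) ∼ (v + sgn j • eᵢ, j + 1)`. [folklore] -/
theorem adj_rung_sgn (v : Site 2) (j : Fin 2) (i : Fin 2) : graph.Adj (v, j) (v + sgn j • e i, j + 1) := by
  fin_cases j
  · simpa [sgn] using adj_rung v i
  · simpa [sgn, sub_eq_add_neg] using adj_rung' v i

/-- The six neighbours of `(v, j)`: `(v ± eᵢ, j)` inside the sheet and the two rungs `(v + sgn j • eᵢ, j + 1)`. [folklore] -/
def nbrs (a : Vtx) : Finset Vtx :=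
  {(a.1 + e 0, a.2), (a.1 + e 1, a.2), (a.1 - e 0, a.2), (a.1 - e 1, a.2), (a.1 + sgn a.2 • e 0, a.2 + 1), (a.1 + sgn a.2 • e 1, a.2 + 1)}

/-- Every neighbour is one of the six candidates. [folklore] -/
theorem mem_nbrs_of_adj {a b : Vtx} (h : graph.Adj a b) : b ∈ nbrs a := by
  obtain ⟨v, j⟩ := a
  obtain ⟨w, k⟩ := b
  obtain ⟨-, h | h⟩ := (adj_iff _ _).1 h
  · rcases h with ⟨hk, hw⟩ | ⟨hj, hk, hw⟩
    · simp only at hk hw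
      subst hk
      rcases hw with rfl | rfl <;> simp [nbrs]
    · simp only at hj hk hw
      subst hj hk
      rcases hw with rfl | rfl <;> simp [nbrs, sgn]
  · rcases h with ⟨hk, hw⟩ | ⟨hk, hj, hw⟩
    · simp only at hk hw
      subst hk
      rcases hw with hw | hw
      · have : w = v - e 0 := by rw [hw, add_sub_cancel_right]
        subst this; simp [nbrs]
      · have : w = v - e 1 := by rw [hw, add_sub_cancel_right]
        subst this; simp [nbrs]
    · simp only at hk hj hw
      subst hk hj
      rcases hw with hw | hw
      · have : w = v - e 0 := by rw [hw, add_sub_cancel_right]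
        subst this; simp [nbrs, sgn, sub_eq_add_neg]
      · have : w = v - e 1 := by rw [hw, add_sub_cancel_right]
        subst this; simp [nbrs, sgn, sub_eq_add_neg]

/-- Conversely every candidate is a neighbour. [folklore] -/
theorem adj_of_mem_nbrs {a b : Vtx} (h : b ∈ nbrs a) : graph.Adj a b := by
  simp only [nbrs, Finset.mem_insert, Finset.mem_singleton] at h
  obtain ⟨v, j⟩ := a
  rcases h with rfl | rfl | rfl | rfl | rfl | rfl
  · exact adj_axis v j 0
  · exact adj_axis v j 1
  · exact adj_axis' v j 0
  · exact adj_axis' v j 1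
  · exact adj_rung_sgn v j 0
  · exact adj_rung_sgn v j 1

/-- The neighbour set lies in the candidate set. [folklore] -/
theorem neighborSet_subset (a : Vtx) : graph.neighborSet a ⊆ ↑(nbrs a) := fun _ hb => mem_nbrs_of_adj hb

/-- `X` is locally finite. [folklore] -/
instance graph_locallyFinite : graph.LocallyFinite := fun a => ((Finset.finite_toSet _).subset (neighborSet_subset a)).fintype

/-- The neighbours of `(v, j)` are exactly the six candidates. [folklore] -/
theorem neighborFinset_eq (a : Vtx) : graph.neighborFinset a = nbrs a :=
  Finset.ext fun _ => ⟨fun hb => mem_nbrs_of_adj ((mem_neighborFinset _ _ _).1 hb), fun hb => (mem_neighborFinset _ _ _).2 (adj_of_mem_nbrs hb)⟩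

/-- Every vertex has degree `≤ 6`. [folklore] -/
theorem degree_le (a : Vtx) : graph.degree a ≤ 6 := by
  rw [← card_neighborFinset_eq_degree, neighborFinset_eq]
  unfold nbrs
  refine (Finset.card_insert_le _ _).trans (Nat.succ_le_succ ?_)
  refine (Finset.card_insert_le _ _).trans (Nat.succ_le_succ ?_)
  refine (Finset.card_insert_le _ _).trans (Nat.succ_le_succ ?_)
  refine (Finset.card_insert_le _ _).trans (Nat.succ_le_succ ?_)
  refine (Finset.card_insert_le _ _).trans (Nat.succ_le_succ ?_)
  rw [Finset.card_singleton]

/-- Along a bond the position changes by a vector of sup-norm `≤ 1`. [folklore] -/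
theorem abs_sub_le {a b : Vtx} (h : graph.Adj a b) (i : Fin 2) : |b.1 i - a.1 i| ≤ 1 := by
  have hb := mem_nbrs_of_adj h
  simp only [nbrs, Finset.mem_insert, Finset.mem_singleton] at hb
  obtain ⟨v, j⟩ := a
  rcases hb with rfl | rfl | rfl | rfl | rfl | rfl <;>
    simp only [Pi.add_apply, Pi.sub_apply, add_sub_cancel_left, sub_sub_cancel_left, abs_neg]
  · exact abs_e_le 0 i
  · exact abs_e_le 1 i
  · exact abs_e_le 0 i
  · exact abs_e_le 1 i
  · exact abs_sgn_smul_e_le j 0 i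
  · exact abs_sgn_smul_e_le j 1 i

/-! ## §2 `X` is connected -/

/-- Walking `n` axis steps inside a sheet. [folklore] -/
theorem reachable_add_nsmul (v : Site 2) (j : Fin 2) (i : Fin 2) (n : ℕ) : graph.Reachable (v, j) (v + n • e i, j) := by
  induction n with
  | zero => simp
  | succ n ih =>
    refine ih.trans (Adj.reachable ?_)
    have := adj_axis (v + n • e i) j i
    rwa [add_assoc, ← succ_nsmul] at this

/-- Walking `n` axis steps backwards inside a sheet. [folklore] -/
theorem reachable_sub_nsmul (v : Site 2) (j : Fin 2) (i : Fin 2) (n : ℕ) : graph.Reachable (v, j) (v - n • e i, j) := by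
  induction n with
  | zero => simp
  | succ n ih =>
    refine ih.trans (Adj.reachable ?_)
    have := adj_axis' (v - n • e i) j i
    rwa [sub_sub, ← succ_nsmul] at this

/-- Walking an integer multiple of an axis vector inside a sheet. [folklore] -/
theorem reachable_add_zsmul (v : Site 2) (j : Fin 2) (i : Fin 2) (n : ℤ) : graph.Reachable (v, j) (v + n • e i, j) := by
  cases n with
  | ofNat n => rw [Int.ofNat_eq_natCast, natCast_zsmul]; exact reachable_add_nsmul v j i n
  | negSucc n => rw [negSucc_zsmul, ← sub_eq_add_neg]; exact reachable_sub_nsmul v j i (n + 1)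

/-- `v = v₀ e₀ + v₁ e₁`. [folklore] -/
theorem eq_sum_e (v : Site 2) : v = v 0 • e 0 + v 1 • e 1 := by
  funext i
  fin_cases i <;> simp [e]

/-- Every vertex of a sheet is joined to the origin of that sheet. [folklore] -/
theorem reachable_origin (v : Site 2) (j : Fin 2) : graph.Reachable ((0 : Site 2), j) (v, j) := by
  have h := (reachable_add_zsmul 0 j 0 (v 0)).trans (reachable_add_zsmul (0 + v 0 • e 0) j 1 (v 1))
  rwa [zero_add, ← eq_sum_e v] at h

/-- **`X` is connected**: inside sheet `0` walk the position; sheet `1` is joined to sheet `0` by a skew rung. [folklore] -/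
theorem connected : graph.Connected := by
  haveI : Nonempty Vtx := ⟨((0 : Site 2), 0)⟩
  refine Connected.mk fun a b => ?_
  suffices H : ∀ w : Vtx, graph.Reachable ((0 : Site 2), 0) w from (H a).symm.trans (H b)
  rintro ⟨v, j⟩
  fin_cases j
  · exact reachable_origin v 0
  · exact ((reachable_origin (v - e 0) 0).trans (adj_rung' v 0).symm.reachable)

/-! ## §3 Frames: the translations by `ℤ²`, a subgroup of `Aut(X)` with two orbits -/

/-- Translating the position preserves adjacency. [folklore] -/
theorem adj_shift {a b : Vtx} (u : Site 2) (h : graph.Adj a b) : graph.Adj (a.1 + u, a.2) (b.1 + u, b.2) := by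
  have hb := mem_nbrs_of_adj h
  simp only [nbrs, Finset.mem_insert, Finset.mem_singleton] at hb
  obtain ⟨v, j⟩ := a
  rcases hb with rfl | rfl | rfl | rfl | rfl | rfl <;> simp only
  · rw [add_right_comm]; exact adj_axis _ _ 0
  · rw [add_right_comm]; exact adj_axis _ _ 1
  · rw [sub_add_eq_add_sub]; exact adj_axis' _ _ 0
  · rw [sub_add_eq_add_sub]; exact adj_axis' _ _ 1
  · rw [add_right_comm]; exact adj_rung_sgn _ _ 0
  · rw [add_right_comm]; exact adj_rung_sgn _ _ 1

/-- **Translation of the position** `(w, j) ↦ (w + u, j)` (left multiplication by `u ∈ ℤ² ⊴ ℤ² ⋊ C₂`). [cite: BenjaminiSchramm1996, §2] -/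
def shiftIso (u : Site 2) : graph ≃g graph where
  toEquiv := Equiv.prodCongr (Equiv.addRight u) (Equiv.refl _)
  map_rel_iff' := by
    intro a b
    show graph.Adj (a.1 + u, a.2) (b.1 + u, b.2) ↔ graph.Adj a b
    refine ⟨fun h => ?_, adj_shift u⟩
    have := adj_shift (-u) h
    simpa using this

/-- `shiftIso u (w, j) = (w + u, j)`. [folklore] -/
@[simp] theorem shiftIso_apply (u : Site 2) (a : Vtx) : shiftIso u a = (a.1 + u, a.2) := rfl

/-- The translations as a homomorphism `ℤ² → Aut(X)`. [folklore] -/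
def shiftHom : Multiplicative (Site 2) →* (graph ≃g graph) where
  toFun u := shiftIso (Multiplicative.toAdd u)
  map_one' := RelIso.ext fun a => by simp
  map_mul' u u' := RelIso.ext fun a => by
    simp only [shiftIso_apply, toAdd_mul, RelIso.mul_apply]
    rw [add_right_comm, add_assoc]

/-- `shiftHom u (w, j) = (w + u, j)`. [folklore] -/
@[simp] theorem shiftHom_apply (u : Multiplicative (Site 2)) (a : Vtx) : shiftHom u a = (a.1 + Multiplicative.toAdd u, a.2) := rfl

/-- **The frames**: the subgroup `A ≤ Aut(X)` of translations of the position. [cite: BenjaminiSchramm1996, §2] -/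
def transl : Subgroup (graph ≃g graph) := shiftHom.range

/-- Membership in `A`: `α = shiftIso u` for some `u`. [folklore] -/
theorem mem_transl {α : graph ≃g graph} : α ∈ transl ↔ ∃ u : Site 2, shiftIso u = α := by
  rw [transl, MonoidHom.mem_range]
  exact ⟨fun ⟨u, hu⟩ => ⟨Multiplicative.toAdd u, hu⟩, fun ⟨u, hu⟩ => ⟨Multiplicative.ofAdd u, hu⟩⟩

/-- The transversal: the origins of the two sheets. [folklore] -/
def reps : Finset Vtx := {((0 : Site 2), 0), ((0 : Site 2), 1)}

/-- A representative has position `0`. [folklore] -/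
theorem fst_eq_zero_of_mem_reps {r : Vtx} (hr : r ∈ reps) : r.1 = 0 := by
  simp only [reps, Finset.mem_insert, Finset.mem_singleton] at hr
  rcases hr with rfl | rfl <;> rfl

/-- **`reps` meets every `A`-orbit at most once**: a translation fixing the position `0` of a representative is the identity on positions. [folklore] -/
theorem reps_trans : ∀ r ∈ reps, ∀ r' ∈ reps, ∀ α ∈ transl, α r = r' → r = r' := by
  intro r hr r' hr' α hα h
  obtain ⟨u, rfl⟩ := mem_transl.1 hα
  rw [shiftIso_apply] at h
  have h2 := congrArg Prod.snd h
  dsimp only at h2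
  exact Prod.ext (by rw [fst_eq_zero_of_mem_reps hr, fst_eq_zero_of_mem_reps hr']) h2

/-- **`reps` meets every `A`-orbit**: `(v, j) = shiftIso v (0, j)`. [folklore] -/
theorem reps_cover : ∀ w : Vtx, ∃ α ∈ transl, ∃ r ∈ reps, α r = w := by
  rintro ⟨v, j⟩
  refine ⟨shiftIso v, mem_transl.2 ⟨v, rfl⟩, ((0 : Site 2), j), ?_, ?_⟩
  · fin_cases j <;> simp [reps]
  · simp

/-! ## §4 The chart `(v, j) ↦ v` and the unconditional theorem -/

/-- The chart is translated by `A`: `φ (α w) = φ w + (φ (α t) − φ t)` with `t = (0, 0)`. [folklore] -/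
theorem chart_transl : ∀ α ∈ transl, ∀ w : Vtx, (α w).1 = w.1 + ((α (((0 : Site 2), (0 : Fin 2)) : Vtx)).1 - (((0 : Site 2), (0 : Fin 2)) : Vtx).1) := by
  intro α hα w
  obtain ⟨u, rfl⟩ := mem_transl.1 hα
  simp

/-- The chart is constant on the transversal. [folklore] -/
theorem chart_reps : ∀ r ∈ reps, ∀ r' ∈ reps, r.1 = r'.1 := fun r hr r' hr' => by
  rw [fst_eq_zero_of_mem_reps hr, fst_eq_zero_of_mem_reps hr']

/-- `1`-range along the bonds at the representatives (indeed along every bond). [folklore] -/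
theorem chart_lip : ∀ r ∈ reps, ∀ w : Vtx, graph.Adj r w → ∀ i : Fin 2, |w.1 i - r.1 i| ≤ ((1 : ℕ) : ℤ) :=
  fun _ _ _ h i => by exact_mod_cast abs_sub_le h i

/-- **Exact unit steps along single bonds at the representatives** (indeed at every vertex): the in-sheet axis steps. [this work] -/
theorem chart_step (a : Vtx) (i : Fin 2) (σ : ℤˣ) : ∃ w : Vtx, graph.Adj a w ∧ w.1 = a.1 + Pi.single i (((1 : ℕ) : ℤ) * σ) := by
  refine ⟨(a.1 + Pi.single i (σ : ℤ), a.2), ?_, by simp⟩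
  rcases Int.units_eq_one_or σ with rfl | rfl
  · simpa [e] using adj_axis a.1 a.2 i
  · have h := adj_axis' a.1 a.2 i
    have he : a.1 - e i = a.1 + Pi.single i (((-1 : ℤˣ) : ℤ)) := by
      rw [Units.val_neg, Units.val_one, sub_eq_add_neg, e, Pi.single_neg]
    rwa [he] at h

/-- **THEOREM (unconditional).  `θ_v(p_c) = 0` at every vertex of the skew bilayer `X = Cay(ℤ² ⋊ C₂; τ₀, τ₁, τ₀σ, τ₁σ)`** — a Cayley graph of a group
with finite abelianisation (virtually `ℤ²`), by the orbit theorem with TWO orbits (the sheets) of the translation subgroup `ℤ² ≤ Aut(X)`, chart = position,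
`N = 1`. builds on p205010 (kernel theorem, internal audit signed; external expert review pending).
[cite: BenjaminiSchramm1996, Conj. 4; §2] [cite: KozmaNitzan2024, §4 p. 16 (Lemma 8)] -/
theorem criticalContinuity (v : Vtx) : theta graph v (criticalProbIOf graph v) = 0 :=
  AutChart.criticalContinuity_of_autSubgroup_finite_orbits connected transl reps reps_trans reps_cover Prod.fst
    (t := (((0 : Site 2), (0 : Fin 2)) : Vtx)) chart_transl chart_reps 1 le_rfl chart_lip (fun r _ i σ => chart_step r i σ) v

/-- **… and the same-`p` drop at every vertex**: every `p` with `θ_v(p) > 0` admits `q < p` with `θ_v(q) > 0`. [cite: BenjaminiSchramm1996, Conj. 4] -/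
theorem drop (v : Vtx) (p : unitInterval) (hθ : 0 < theta graph v p) : ∃ q : unitInterval, (q : ℝ) < p ∧ 0 < theta graph v q :=
  drop_at_of_critical graph v (P := fun _ => True) (fun _ => criticalContinuity v) p trivial hθ

/-! ## §5 ERRATUM (words only; kernel content above unchanged) — 2026-08-27, located by the refuter p5 gen 27 (bus #5872 (E3)), ACK hp-8 gen 58

The header's sentence 'NO Cayley graph of `Γ` carries a chart translated by a vertex-transitive group of left translations' is a statement about the
PRESENTATION (`b₁(ℤ² ⋊ C₂) = 0`), NOT about the graph: `X` has more automorphisms than `Γ`.  The SHEET SWAP `α(v, 0) = (v + e₀, 1)`, `α(v, 1) = (v − e₁, 0)`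
is an automorphism of `X` commuting with the translations (`α²` = translation by `e₀ − e₁`), `⟨translations, α⟩ ≅ ℤ²` acts simply transitively, and
`X = Cay(ℤ²; ±f, ±g, ±(2f + g))` (`f = α`, `g = τ₁`, `τ₀ = 2f + g`) — the square lattice with the `(2,1)`-bonds — whose `θ(p_c) = 0` was ALREADY a theorem
of the tree (every finite generating set of `ℤ^d`).  So this file is a REGRESSION instance of the orbit theorem (a second, independent route to a known
customer), NOT a new reach, and nothing in it may be read as '`X` is outside every one-type node'.  Kernel form of the located fact: «CayleyZ2DihSkewBilayerSwap»
(`Z2DihSkew.swapIso`, `Z2DihSkew.vertexTransitive : ∀ a b, ∃ γ : X ≃g X, γ a = b`).  The genuinely multi-type (NOT vertex-transitive, by degrees `5/7`)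
customer of P3-NILPOTENT §20.2 is (c4) «Z2PeriodicBilayerNonTransitive» (`Z2BilayerNE.not_vertexTransitive`).  Rule of record (P5-SHARPNESS §59.3 / P3-NILPOTENT
§20.7): 'outside every one-type node' requires an Aut-level reason (degree/orbit invariant, Aut-free no-chart proof, or a computed automorphism group). -/

/-! ## §6 (append 2026-08-27) Conj. 4 in its own shape on `X` -/

/-- **Conj. 4 in its own shape on `X`: `p_c < 1 ∧ θ_v(p_c) = 0`** (p3 g28's §6 front-end `AutChart.conj4_of_autSubgroup_finite_orbits`, by name; a regression
instance — see §5). [cite: BenjaminiSchramm1996, Conj. 4; §2 Conj. 1] -/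
theorem conj4 (v : Vtx) : criticalProb graph v < 1 ∧ theta graph v (criticalProbIOf graph v) = 0 :=
  AutChart.conj4_of_autSubgroup_finite_orbits connected transl reps reps_trans reps_cover Prod.fst
    (t := (((0 : Site 2), (0 : Fin 2)) : Vtx)) chart_transl chart_reps 1 le_rfl chart_lip (fun r _ i σ => chart_step r i σ) v

end Z2DihSkew

end Summit.CriticalPhenomena.PercolationContinuityZ3.Theorems.Transplant

end
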